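/-
Copyright (c) 2026. All rights reserved.
Released under Apache 2.0 license as described in the file LICENSE.
-/
import Literature.AlgebraicGeometry.ComplexMultiplication.HyperellipticJacobianLevelForty
import HarnessLib

/-!
# GGL 2024 Thm. 3.0, last statement, in full: the CM fields `ℚ(ζ_d − ζ_d⁻¹) ⊂ ℂ` of the `Y_d` (`4 ∣ d ≥ 8` non-exceptional) are
# pairwise distinct, so `Y_d ⟂ Y_{d′}` for all `d ≠ d′`

Layer `Literature/AlgebraicGeometry/ComplexMultiplication`, namespace `…ComplexMultiplication.HyperellipticJacobian`; closes the honest column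
«`Y_d` vs `Y_{d′}` with `φ(d) = φ(d′)`, `d ≡ d′ (mod 8)`» of F12 ∕ F16–F22.  THEOREMS ONLY (no definition, no named fact, no `sorry`, no instance).

## The print and the argument

A. Gallese, H. Goodson, D. Lombardo, arXiv:2405.20394 [GalleseGoodsonLombardo2024] (held `paper:arxiv-2405.20394`, p0012): THM. 3.0 (5) «`Y_d` … with
complex multiplication by `ℚ(ζ_d − ζ_d⁻¹)`» and the last statement «all `X_d` with odd `d` and all `Y_d` are pairwise non-isogenous».  In the tree the
reflex field of the lower-half type `Φ_d` of `ℚ(ζ_d)`, read in `ℂ` through any embedding `x`, is `K*(Φ_d) = ℚ(xζ_d − (xζ_d)⁻¹)`, of degree `φ(d)/2`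
(F10 `traceField_eq_adjoin_of_four_dvd`), and `Hom ≠ 0` forces equal reflex fields (F12 `IsCMTypeRealisation.orthogonal_of_traceField_ne`).  The
reflex fields are separated as subfields of `ℂ` as follows (`4 ∣ d, d′`, both `≥ 8`, both `∉ {20, 24, 60}`, `d ≠ d′`).
* `8 ∣ d` (§2): `i ∉ K*(Φ_d)` (F12) but `xζ_d = (w − v·xζ_d^{d/4})/2` with `w = x(ζ − ζ⁻¹)`, `v = x(ζ^{d/4}(ζ + ζ⁻¹)) ∈ K*(Φ_d)` — both are fixed
  by `ζ ↦ −ζ⁻¹` — so `K*(Φ_d) = K*(Φ′)` for ANY type `Φ′` of `ℚ(ζ_m)` with `4 ∣ m` puts a primitive `d`-th root of unity inside `x′(ℚ(ζ_m))`, whence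
  `d ∣ m` (§1: the roots of unity of `ℚ(ζ_m)`, `m` even, have order dividing `m` — Mathlib's `l ∣ 2m` sharpened by the degree count
  `φ(lcm) ≤ φ(m)`).  Hence `Y_d ⟂` every CM abelian variety with CM by `ℚ(ζ_m)`, `4 ∣ m`, `d ∤ m`.
* `d ≡ d′ ≡ 4 (mod 8)` (§3): if `E = K*(Φ_d) = K*(Φ_{d′})` then `φ(d) = φ(d′)`; `a = xζ_d` is a root of `X² − wX − 1 ∈ E[X]` and likewise `a′`, so
  `E(a, a′)` has degree `≤ 4[E : ℚ] = 2φ(d)` and contains primitive `d`-th and `d′`-th roots of unity, whence `φ(lcm(d, d′)) ≤ 2φ(d)` (Mathlib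
  `IsPrimitiveRoot.lcm_totient_le_finrank`); as `lcm(d, d′)/d` is odd this forces `lcm ∈ {d, 3d}`, symmetrically `lcm ∈ {d′, 3d′}`, and `d ≠ d′`
  would give `{d, d′} = {e, 3e}` with `φ(3e) ≥ 2φ(e) > φ(e)` — contradiction.
* `8 ∣ d`, `d′ ≡ 4 (mod 8)`: §2 (or F12: `i`).
Together (§4): **`K*(Φ_d) ≠ K*(Φ_{d′})` and `Y_d ⟂ Y_{d′}` (all realisations: `Hom = 0` both ways, not isogenous) for all `d ≠ d′`**; with F12 ∕ F16 ∕ F17 ∕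
F19–F22 for the exceptional levels and `X_4` (where the one compatible pair is `(4, 12)`, F12 `exists_hom_ne_zero_four_twelve`) this is Thm. 3.0's
last statement for every pair of levels.

## What is proved

`dvd_of_isPrimitiveRoot_of_even` (§1); `traceField_ne_of_eight_dvd_of_not_dvd`, `orthogonal_fourDvd_of_eight_dvd_of_not_dvd` (§2);
`totient_lcm_le_of_traceField_eq`, `traceField_ne_of_not_eight_dvd` (§3); **`traceField_ne_of_four_dvd_of_ne`**, **`orthogonal_fourDvd_of_ne`**
(§4); riders `orthogonal_four_fourDvd_of_ne_twelve` (the `X_4` column), `orthogonal_twentyFour_fourDvd_of_totient_ne_four`, `orthogonal_twentyFour_sixty`,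
`orthogonal_sixty_fourDvd_of_eight_dvd` (§4).  With these every pair of levels in Thm. 3.0's last statement is a tree theorem:
`X_d ∕ X_{2n}` vs `4 ∣ d′` (F12, F16, F17, F19, F20), `X_4` vs `Y_d` (`d ≠ 12`; here), `Y_d` vs `Y_{d′}` non-exceptional (here), `Y_{20}` ∕ `Y_{24}` ∕ `Y_{60}`
vs the rest (F16, F17, F20, F21, F22, here).

## Honest column ∕ NOT here

The curve `y² = x^m + 1` itself; `End⁰(J_m)` for general composite `m` (a divisor-indexed assembly — all pairwise relations are now available).
`HC_CM` is not touched.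

## References

* [GalleseGoodsonLombardo2024] arXiv:2405.20394 — §3 Thm. 3.0 ((5), last statement), §3.2 Lemma 12, §3.5 Prop. 13 (proof).
* [Washington1997] L. Washington, *Introduction to Cyclotomic Fields* — Ch. 2, Prop. 2.4 ∕ Ex. 2.3 (roots of unity in `ℚ(ζ_n)`), Thm. 2.5.
* [Shimura1998] G. Shimura — §8.3 Prop. 28, §8.4 Example (1).
* [MilneCM2006] J. S. Milne — Ch. I §1 Prop. 1.18 (c), §3 Prop. 3.13.

## Provenance

Cell `pub-hodgecm2` (COR-CM), KEPT Literature lane `lit-deligne-3` gen 52 (claim GGL24-REFLEX-SEPARATION; count-neutral, own lane).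
-/

noncomputable section

open CategoryTheory NumberField Module Polynomial

namespace Literature.AlgebraicGeometry.ComplexMultiplication

open Literature.AlgebraicGeometry.Motives
open Literature.AlgebraicGeometry.HodgeTheory (complexBetti)
open Literature.NumberTheory.ComplexMultiplication

namespace HyperellipticJacobian

open Literature.AlgebraicGeometry.Pohlmann1968 Literature.AlgebraicGeometry.Pohlmann1968.Cyclotomic

/-! ## §1 Roots of unity in `ℚ(ζ_m)`, `m` even, have order dividing `m` -/

section RootsOfUnity

/-- **The roots of unity of `ℚ(ζ_m)`, `m` even, have order dividing `m`**: a primitive `d`-th root of unity in an `m`-th cyclotomic extension of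
`ℚ` has `d ∣ 2m` (Mathlib), and `d ∤ m` would make `lcm(d, m) = 2m`, of totient `2φ(m) > φ(m) = [ℚ(ζ_m) : ℚ]` — impossible since the field
contains a primitive `lcm(d, m)`-th root of unity. [cite: Washington1997, Ch. 2 Ex. 2.3 and Thm. 2.5] -/
theorem dvd_of_isPrimitiveRoot_of_even (m : ℕ) [NeZero m] {K : Type} [Field K] [NumberField K] [IsCyclotomicExtension {m} ℚ K]
    (hm : Even m) {y : K} {d : ℕ} (hd : d ≠ 0) (hy : IsPrimitiveRoot y d) : d ∣ m := by
  have hm0 : 0 < m := NeZero.pos m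
  have hζ := IsCyclotomicExtension.zeta_spec m ℚ K
  have key := IsPrimitiveRoot.lcm_totient_le_finrank hy hζ
    (cyclotomic.irreducible_rat (Nat.lcm_pos (Nat.pos_of_ne_zero hd) hm0))
  rw [IsCyclotomicExtension.finrank K (cyclotomic.irreducible_rat hm0)] at key
  by_contra hdm
  have h2 : d ∣ 2 * m := hy.dvd_of_isCyclotomicExtension m hd
  -- `lcm(d, m) = 2m`
  obtain ⟨c, hc⟩ := Nat.dvd_lcm_right d m
  have hlcm2 : Nat.lcm d m ∣ 2 * m := Nat.lcm_dvd h2 (dvd_mul_left m 2)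
  rw [hc] at hlcm2
  have hc2 : c ∣ 2 := by
    obtain ⟨e, he⟩ := hlcm2
    refine ⟨e, Nat.eq_of_mul_eq_mul_left hm0 ?_⟩
    calc m * 2 = 2 * m := mul_comm _ _
      _ = m * c * e := he
      _ = m * (c * e) := mul_assoc _ _ _
  rcases (Nat.dvd_prime Nat.prime_two).1 hc2 with rfl | rfl
  · exact hdm (by simpa [hc] using Nat.dvd_lcm_left d m)
  · rw [hc, mul_comm m 2, Nat.totient_mul_of_prime_of_dvd Nat.prime_two hm.two_dvd] at key
    have hpos := Nat.totient_pos.2 hm0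
    omega

end RootsOfUnity

/-! ## §2 `8 ∣ d`: `K*(Φ_d)` lies in no `x′(ℚ(ζ_m))` with `d ∤ m`, `4 ∣ m` -/

section EightDvd

variable {d : ℕ} [NeZero d] {K : Type} [Field K] [NumberField K] [IsCyclotomicExtension {d} ℚ K] {Φ : CMType K}
  {A : AbelianVariety ℂ} {ι : 𝓞 K →+* End A} {θ : K →+* Module.End ℂ (complexBetti A.X 1)}
  (m : ℕ) [NeZero m] {K' : Type} [Field K'] [NumberField K'] [IsCyclotomicExtension {m} ℚ K'] {Φ' : CMType K'}
  {A' : AbelianVariety ℂ} {ι' : 𝓞 K' →+* End A'} {θ' : K' →+* Module.End ℂ (complexBetti A'.X 1)}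

/-- A primitive `d`-th root of unity with `d` even has `ζ^{d/2} = −1`. [folklore] -/
private theorem pow_div_two_eq_neg_one {F : Type} [Field F] {ζ : F} (hζ : IsPrimitiveRoot ζ d) (h2 : 2 ∣ d) :
    ζ ^ (d / 2) = -1 := by
  have hd : d ≠ 0 := NeZero.ne d
  have hsq : (ζ ^ (d / 2)) ^ 2 = 1 := by
    rw [← pow_mul, Nat.div_mul_cancel h2]
    exact hζ.pow_eq_one
  rcases sq_eq_one_iff.1 hsq with h | h
  · exact absurd h (hζ.pow_ne_one_of_pos_of_lt (Nat.div_pos (Nat.le_of_dvd (Nat.pos_of_ne_zero hd) h2) two_pos).ne'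
      (Nat.div_lt_self (Nat.pos_of_ne_zero hd) one_lt_two))
  · exact h

/-- **`8 ∣ d`, `d ≠ 24`: the reflex field `K*(Φ_d) ⊂ ℂ` differs from the reflex field of EVERY CM type of `ℚ(ζ_m)` when `4 ∣ m` and `d ∤ m`.**
With `j = ζ^{d/4}` (`j² = −1`), `w = ζ − ζ⁻¹` and `v = j(ζ + ζ⁻¹)` are fixed by `σ : ζ ↦ −ζ⁻¹` (`σ j = j⁻¹ = −j` as `d/4` is even), so `x w, x v ∈ K*(Φ_d) = x(K₁)`
(F8 ∕ F10) and `xζ = (x w − x v · x j)/2`; if `K*(Φ_d) = K*(Φ′) ⊆ x′(ℚ(ζ_m))`, which also contains `±x j`, then `xζ ∈ x′(ℚ(ζ_m))` is a primitive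
`d`-th root of unity there, and `d ∣ m` (§1). [cite: GalleseGoodsonLombardo2024, §3 Thm. 3.0 (5), (last statement) and §3.2 Lemma 12]
[cite: Shimura1998, §8.3 Prop. 28 and §8.4 Example (1)] [cite: Washington1997, Ch. 2 Ex. 2.3] -/
theorem traceField_ne_of_eight_dvd_of_not_dvd (h8d : 8 ∣ d) (h24 : d ≠ 24) (Φ : CMType K)
    (hΦ : ∀ σ : K →+* ℂ, σ ∈ Φ.1 ↔ 2 * (expOf d K σ).val < d) (h4 : 4 ∣ m) (hdm : ¬ d ∣ m) (Φ' : CMType K') :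
    traceField Φ ≠ traceField Φ' := by
  classical
  intro heq
  haveI : IsAbelianGalois ℚ K := IsCyclotomicExtension.isAbelianGalois {d} ℚ K
  haveI : IsGalois ℚ K' := IsCyclotomicExtension.isGalois {m} ℚ K'
  have hd0 : d ≠ 0 := NeZero.ne d
  have h4d : 4 ∣ d := (show (4 : ℕ) ∣ 8 by norm_num).trans h8d
  have h8 : 8 ≤ d := Nat.le_of_dvd (Nat.pos_of_ne_zero hd0) h8d
  have h20 : d ≠ 20 := by rintro rfl; norm_num at h8d
  have h60 : d ≠ 60 := by rintro rfl; norm_num at h8d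
  obtain ⟨x⟩ := (inferInstance : Nonempty (K →+* ℂ))
  obtain ⟨x'⟩ := (inferInstance : Nonempty (K' →+* ℂ))
  -- the primitive sub-pair `(K₁, Φ₁)` and the involution `σ`
  obtain ⟨K₁, Φ₁, h₁, hp₁, -⟩ := exists_primitive_inducedCMType_index_two_of_four_dvd h4d h8 h20 h24 h60 Φ hΦ
  obtain ⟨σ, hσζ, -, hfix, -, hw, -, -, -⟩ := eq_fixedField_and_eq_adjoin_of_primitive_of_four_dvd h4d h8 h20 h24 h60 Φ hΦ Φ₁ h₁ hp₁
  have htr : traceField Φ = K₁.map x.toRatAlgHom := traceField_eq_map_of_primitive_subpair Φ Φ₁ h₁ hp₁ x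
  set ζ := zetaOf d K with hζdef
  have hζ : IsPrimitiveRoot ζ d := IsCyclotomicExtension.zeta_spec d ℚ K
  have hζ0 : ζ ≠ 0 := hζ.ne_zero hd0
  -- `j = ζ^{d/4}`, `j² = −1`, `σ j = −j`
  set j := ζ ^ (d / 4) with hjdef
  have hj2 : j ^ 2 = -1 := by
    have h : j ^ 2 = ζ ^ (d / 2) := by
      rw [hjdef, ← pow_mul]
      congr 1
      obtain ⟨e, rfl⟩ := h4d
      omega
    rw [h]
    exact pow_div_two_eq_neg_one hζ ((show (2 : ℕ) ∣ 4 by norm_num).trans h4d)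
  have hj0 : j ≠ 0 := pow_ne_zero _ hζ0
  have hjinv : j⁻¹ = -j := inv_eq_of_mul_eq_one_right (by rw [mul_neg, ← sq, hj2, neg_neg])
  have heven : Even (d / 4) := by
    obtain ⟨e, rfl⟩ := h8d
    exact ⟨e, by omega⟩
  have hσj : σ j = -j := by
    rw [hjdef, map_pow, hσζ, heven.neg_pow, inv_pow, ← hjdef, hjinv]
  -- `v = j (ζ + ζ⁻¹)` is fixed by `σ`
  set v := j * (ζ + ζ⁻¹) with hvdef
  have hσv : σ v = v := by
    rw [hvdef, map_mul, hσj, map_add, map_inv₀, hσζ, inv_neg, inv_inv]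
    ring
  have hv : v ∈ K₁ := (hfix v).2 hσv
  -- `x w`, `x v` lie in the reflex field, hence in `x′(K′)`
  have hle : traceField Φ' ≤ x'.toRatAlgHom.fieldRange := traceField_le_fieldRange (AlgHom.id ℚ K') x' Φ'
  have hmemw : x (ζ - ζ⁻¹) ∈ x'.toRatAlgHom.fieldRange := by
    apply hle; rw [← heq, htr]; exact (IntermediateField.mem_map K₁).2 ⟨_, hw, rfl⟩
  have hmemv : x v ∈ x'.toRatAlgHom.fieldRange := by
    apply hle; rw [← heq, htr]; exact (IntermediateField.mem_map K₁).2 ⟨_, hv, rfl⟩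
  -- `x j` is `±` the primitive fourth root of unity `x′(ζ_m^{m/4})` of `x′(K′)`
  have hmemj : x j ∈ x'.toRatAlgHom.fieldRange := by
    set j' := zetaOf m K' ^ (m / 4) with hj'def
    have hj'2 : j' ^ 2 = -1 := by
      have h : j' ^ 2 = zetaOf m K' ^ (m / 2) := by
        rw [hj'def, ← pow_mul]
        congr 1
        obtain ⟨e, rfl⟩ := h4
        omega
      rw [h]
      exact pow_div_two_eq_neg_one (IsCyclotomicExtension.zeta_spec m ℚ K') ((show (2 : ℕ) ∣ 4 by norm_num).trans h4)
    have hxj2 : (x j) ^ 2 = (x' j') ^ 2 := by rw [← map_pow, ← map_pow, hj2, hj'2, map_neg, map_one, map_neg, map_one]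
    rcases sq_eq_sq_iff_eq_or_eq_neg.1 hxj2 with h | h
    · rw [h]; exact ⟨j', rfl⟩
    · rw [h]; exact neg_mem ⟨j', rfl⟩
  -- hence `x ζ = (x w − x v · x j) / 2 ∈ x′(K′)`
  have hζformula : x ζ = (x (ζ - ζ⁻¹) - x v * x j) / 2 := by
    have hxj2 : x j ^ 2 = -1 := by rw [← map_pow, hj2, map_neg, map_one]
    rw [eq_div_iff (two_ne_zero : (2 : ℂ) ≠ 0), hvdef, map_sub, map_mul, map_add, map_inv₀]
    linear_combination (x ζ + (x ζ)⁻¹) * hxj2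
  have hmemζ : x ζ ∈ x'.toRatAlgHom.fieldRange := by
    rw [hζformula]
    exact div_mem (sub_mem hmemw (mul_mem hmemv hmemj)) (by exact_mod_cast natCast_mem x'.toRatAlgHom.fieldRange 2)
  -- a primitive `d`-th root of unity in `K′ = ℚ(ζ_m)`: `d ∣ m`
  obtain ⟨y, hy⟩ := hmemζ
  have hy' : IsPrimitiveRoot y d := by
    have h : IsPrimitiveRoot (x' y) d := by
      rw [show x' y = x ζ from hy]
      exact hζ.map_of_injective x.injective
    exact h.of_map_of_injective x'.injective
  exact hdm (dvd_of_isPrimitiveRoot_of_even m (⟨m / 4 * 2, by obtain ⟨e, rfl⟩ := h4; omega⟩) hd0 hy')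

/-- **`Y_d ⟂` every abelian variety with CM by `ℚ(ζ_m)` (any type), for `8 ∣ d`, `d ≠ 24`, `4 ∣ m`, `d ∤ m`** — in particular `Y_d ⟂ Y_{d′}` for
`8 ∣ d ∤ d′`, `Y_d ⟂ Y_{20}, Y_{60}`, `Y_d ⟂ X_4`, `Y_{16} ⟂ Y_{60}`: `Hom = 0` both ways and non-isogenous, for all realisations.
[cite: GalleseGoodsonLombardo2024, §3 Thm. 3.0 (last statement)] [cite: MilneCM2006, Ch. I §1 Prop. 1.18 (c) and §3 Prop. 3.13] -/
theorem orthogonal_fourDvd_of_eight_dvd_of_not_dvd (h8d : 8 ∣ d) (h24 : d ≠ 24)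
    (hΦ : ∀ σ : K →+* ℂ, σ ∈ Φ.1 ↔ 2 * (expOf d K σ).val < d) (hA : IsCMTypeRealisation Φ A ι θ) (h4 : 4 ∣ m) (hdm : ¬ d ∣ m)
    (hA' : IsCMTypeRealisation Φ' A' ι' θ') :
    (∀ u : A ⟶ A', u = 0) ∧ (∀ v : A' ⟶ A, v = 0) ∧
      ¬ AbelianVariety.IsIsogenous A A' ∧ ¬ AbelianVariety.IsIsogenous A' A :=
  hA.orthogonal_of_traceField_ne hA' (traceField_ne_of_eight_dvd_of_not_dvd m h8d h24 Φ hΦ h4 hdm Φ')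

end EightDvd

/-! ## §3 `d ≡ d′ ≡ 4 (mod 8)`: the compositum bound `φ(lcm(d, d′)) ≤ 2φ(d)` and its arithmetic -/

section Arithmetic

/-- An odd number of totient `≤ 2` is `1` or `3`. [folklore] -/
private theorem eq_one_or_three_of_odd_of_totient_le_two {q : ℕ} (hq : Odd q) (hφ : Nat.totient q ≤ 2) : q = 1 ∨ q = 3 := by
  by_cases hq1 : q = 1
  · exact Or.inl hq1
  right
  have hq0 : 0 < q := hq.pos
  have hpp : q.minFac.Prime := Nat.minFac_prime hq1
  obtain ⟨r, hr⟩ := Nat.minFac_dvd q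
  have hr0 : 0 < r := by
    refine Nat.pos_of_ne_zero ?_
    rintro rfl
    rw [mul_zero] at hr
    omega
  have hrodd : Odd r := hq.of_dvd_nat ⟨q.minFac, hr.trans (mul_comm _ _)⟩
  have hpodd : Odd q.minFac := hq.of_dvd_nat ⟨r, hr⟩
  have hp3 : 3 ≤ q.minFac := by
    have h2 := hpp.two_le
    rcases Nat.eq_or_lt_of_le h2 with h | h
    · rw [← h] at hpodd
      exact absurd hpodd (by decide)
    · omega
  have key : (q.minFac - 1) * Nat.totient r ≤ 2 := by
    calc (q.minFac - 1) * Nat.totient r = Nat.totient q.minFac * Nat.totient r := by rw [Nat.totient_prime hpp]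
      _ ≤ Nat.totient (q.minFac * r) := Nat.totient_super_multiplicative _ _
      _ = Nat.totient q := by rw [← hr]
      _ ≤ 2 := hφ
  have hφr : 0 < Nat.totient r := Nat.totient_pos.2 hr0
  have hp3' : q.minFac = 3 := by
    have : (q.minFac - 1) * 1 ≤ 2 := le_trans (Nat.mul_le_mul_left _ hφr) key
    omega
  have hφr1 : Nat.totient r ≤ 1 := by
    rw [hp3'] at key
    omega
  have hr2 : r ∣ 2 := Nat.dvd_two_of_totient_le_one hr0 hφr1
  have hr1 : r = 1 := by
    rcases (Nat.dvd_prime Nat.prime_two).1 hr2 with h | h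
    · exact h
    · rw [h] at hrodd
      exact absurd hrodd (by decide)
  rw [hr, hp3', hr1]

/-- `4 ∣ k`, `8 ∤ k` ⟹ `k = 4n` with `n` odd. [folklore] -/
private theorem exists_eq_four_mul_odd {k : ℕ} (h4 : 4 ∣ k) (h8n : ¬ 8 ∣ k) : ∃ n, k = 4 * n ∧ Odd n := by
  obtain ⟨n, rfl⟩ := h4
  refine ⟨n, rfl, ?_⟩
  rcases Nat.even_or_odd n with h | h
  · obtain ⟨k, rfl⟩ := h
    exact absurd ⟨k, by ring⟩ h8n
  · exact h

/-- For `d = 4n`, `d′ = 4n′` (`n, n′` odd), `φ(lcm(d, d′)) ≤ 2φ(d)` forces `lcm(d, d′) ∈ {d, 3d}` (`lcm(d, d′)/d` is odd and `φ` is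
super-multiplicative). [folklore] -/
private theorem lcm_eq_or_eq_three_mul {d d' : ℕ} (h4 : 4 ∣ d) (h8n : ¬ 8 ∣ d) (h4' : 4 ∣ d') (h8n' : ¬ 8 ∣ d')
    (hle : Nat.totient (Nat.lcm d d') ≤ 2 * Nat.totient d) : Nat.lcm d d' = d ∨ Nat.lcm d d' = 3 * d := by
  obtain ⟨n, rfl, hn⟩ := exists_eq_four_mul_odd h4 h8n
  obtain ⟨n', rfl, hn'⟩ := exists_eq_four_mul_odd h4' h8n'
  rw [Nat.lcm_mul_left] at hle ⊢
  have hlodd : Odd (Nat.lcm n n') := (hn.mul hn').of_dvd_nat (Nat.lcm_dvd_mul n n')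
  obtain ⟨q, hq⟩ := Nat.dvd_lcm_left n n'
  have hqodd : Odd q := hlodd.of_dvd_nat ⟨n, by rw [hq, mul_comm]⟩
  have hcop : ∀ {k : ℕ}, Odd k → Nat.Coprime 4 k := fun hk => by
    simpa using (Nat.coprime_two_left.2 hk).pow_left 2
  have h4 : Nat.totient 4 = 2 := by decide +kernel
  rw [Nat.totient_mul (hcop hlodd), Nat.totient_mul (hcop hn), h4] at hle
  have hle' : Nat.totient n * Nat.totient q ≤ 2 * Nat.totient n := by
    calc Nat.totient n * Nat.totient q ≤ Nat.totient (n * q) := Nat.totient_super_multiplicative n q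
      _ = Nat.totient (Nat.lcm n n') := by rw [← hq]
      _ ≤ 2 * Nat.totient n := by omega
  have hφn : 0 < Nat.totient n := Nat.totient_pos.2 hn.pos
  have hφq : Nat.totient q ≤ 2 := by
    by_contra h
    have h3 : Nat.totient n * 3 ≤ Nat.totient n * Nat.totient q := Nat.mul_le_mul_left _ (by omega)
    omega
  rcases eq_one_or_three_of_odd_of_totient_le_two hqodd hφq with h1 | h3
  · left
    rw [hq, h1, mul_one]
  · right
    rw [hq, h3]
    ring

/-- The endgame: `φ(d) = φ(d′)`, `lcm ∈ {d, 3d} ∩ {d′, 3d′}` ⟹ `d = d′`. [folklore] -/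
private theorem eq_of_lcm_cases {d d' : ℕ} (hd : d ≠ 0) (hφ : Nat.totient d = Nat.totient d')
    (h : Nat.lcm d d' = d ∨ Nat.lcm d d' = 3 * d) (h' : Nat.lcm d d' = d' ∨ Nat.lcm d d' = 3 * d') : d = d' := by
  have hφ0 : 0 < Nat.totient d := Nat.totient_pos.2 (Nat.pos_of_ne_zero hd)
  have h3 : ∀ k : ℕ, 2 * Nat.totient k ≤ Nat.totient (3 * k) := fun k => by
    calc 2 * Nat.totient k = Nat.totient 3 * Nat.totient k := by rw [Nat.totient_prime Nat.prime_three]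
      _ ≤ Nat.totient (3 * k) := Nat.totient_super_multiplicative 3 k
  rcases h with h | h <;> rcases h' with h' | h'
  · exact h.symm.trans h'
  · -- `d = 3 d′`
    have hdd : d = 3 * d' := h.symm.trans h'
    have := h3 d'
    rw [← hdd, hφ] at this
    omega
  · have hdd : d' = 3 * d := h'.symm.trans h
    have := h3 d
    rw [← hdd, ← hφ] at this
    omega
  · have : 3 * d = 3 * d' := h.symm.trans h'
    omega

end Arithmetic

section FourModEight

variable {d : ℕ} [NeZero d] {K : Type} [Field K] [NumberField K] [IsCyclotomicExtension {d} ℚ K] {Φ : CMType K}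
  {A : AbelianVariety ℂ} {ι : 𝓞 K →+* End A} {θ : K →+* Module.End ℂ (complexBetti A.X 1)}
  {d' : ℕ} [NeZero d'] {K' : Type} [Field K'] [NumberField K'] [IsCyclotomicExtension {d'} ℚ K'] {Φ' : CMType K'}
  {A' : AbelianVariety ℂ} {ι' : 𝓞 K' →+* End A'} {θ' : K' →+* Module.End ℂ (complexBetti A'.X 1)}

/-- Over a field `E ⊂ ℂ` containing `a − a⁻¹`, a non-zero `a ∈ ℂ` generates an extension of degree `≤ 2` (it is a root of
`X² − (a − a⁻¹)X − 1`). [folklore] -/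
private theorem finrank_adjoin_le_two_of_sub_inv_mem (E : IntermediateField ℚ ℂ) {a : ℂ} (ha : a ≠ 0) (hw : a - a⁻¹ ∈ E) :
    IsIntegral E a ∧ Module.finrank E (IntermediateField.adjoin E ({a} : Set ℂ)) ≤ 2 := by
  let c : E := ⟨a - a⁻¹, hw⟩
  let p : E[X] := X ^ 2 - (C c * X + 1)
  have hlt : (C c * X + 1 : E[X]).degree < 2 := by
    refine (degree_add_le _ _).trans_lt (max_lt ((degree_C_mul_X_le c).trans_lt (by norm_num)) ?_)
    rw [degree_one]
    norm_num
  have hmonic : p.Monic := (monic_X_pow 2).sub_of_left (by rwa [degree_X_pow])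
  have hdeg : p.degree = 2 := by
    rw [degree_sub_eq_left_of_degree_lt (by rwa [degree_X_pow]), degree_X_pow]
    rfl
  have heval : aeval a p = 0 := by
    have hc : algebraMap E ℂ c = a - a⁻¹ := rfl
    simp only [p, map_sub, map_add, map_mul, map_pow, aeval_X, aeval_C, map_one, hc]
    field_simp
    ring
  have hint : IsIntegral E a := ⟨p, hmonic, by rwa [← aeval_def]⟩
  refine ⟨hint, ?_⟩
  rw [IntermediateField.adjoin.finrank hint]
  have h := minpoly.degree_le_of_ne_zero E a hmonic.ne_zero heval
  rw [hdeg] at h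
  exact natDegree_le_iff_degree_le.2 h

/-- **The compositum bound.**  If the reflex fields of the lower-half types `Φ_d`, `Φ_{d′}` (`4 ∣ d, d′ ≥ 8`, both non-exceptional) COINCIDE in
`ℂ`, `E = K*(Φ_d) = K*(Φ_{d′})`, then `φ(d) = φ(d′)` and `φ(lcm(d, d′)) ≤ 2φ(d)`: `a = xζ_d` and `a′ = x′ζ_{d′}` have degree `≤ 2` over `E`
(roots of `X² − wX − 1`, `w = a − a⁻¹ ∈ E`, F10), so `E(a, a′) ⊂ ℂ` has degree `≤ 4[E : ℚ] = 2φ(d)` over `ℚ` and contains primitive `d`-th and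
`d′`-th roots of unity (Mathlib `IsPrimitiveRoot.lcm_totient_le_finrank`). [cite: GalleseGoodsonLombardo2024, §3 Thm. 3.0 (5) and §3.2 Lemma 12]
[cite: Shimura1998, §8.4 Example (1)] [cite: Washington1997, Thm. 2.5] -/
theorem totient_lcm_le_of_traceField_eq (h4 : 4 ∣ d) (h8 : 8 ≤ d) (h20 : d ≠ 20) (h24 : d ≠ 24) (h60 : d ≠ 60) (Φ : CMType K)
    (hΦ : ∀ σ : K →+* ℂ, σ ∈ Φ.1 ↔ 2 * (expOf d K σ).val < d)
    (h4' : 4 ∣ d') (h8' : 8 ≤ d') (h20' : d' ≠ 20) (h24' : d' ≠ 24) (h60' : d' ≠ 60) (Φ' : CMType K')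
    (hΦ' : ∀ σ : K' →+* ℂ, σ ∈ Φ'.1 ↔ 2 * (expOf d' K' σ).val < d') (heq : traceField Φ = traceField Φ') :
    Nat.totient (Nat.lcm d d') ≤ 2 * Nat.totient d ∧ Nat.totient d = Nat.totient d' := by
  classical
  obtain ⟨x⟩ := (inferInstance : Nonempty (K →+* ℂ))
  obtain ⟨x'⟩ := (inferInstance : Nonempty (K' →+* ℂ))
  set E := traceField Φ with hE
  have hdeg : 2 * finrank ℚ E = Nat.totient d := two_mul_finrank_traceField_of_four_dvd h4 h8 h20 h24 h60 Φ hΦ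
  have hdeg' : 2 * finrank ℚ E = Nat.totient d' := by
    rw [heq]
    exact two_mul_finrank_traceField_of_four_dvd h4' h8' h20' h24' h60' Φ' hΦ'
  refine ⟨?_, by omega⟩
  haveI : FiniteDimensional ℚ E := Module.finite_of_finrank_pos (finrank_traceField_pos Φ)
  -- the two primitive roots of unity and their traces `a − a⁻¹ ∈ E`
  set a : ℂ := x (zetaOf d K) with ha
  set a' : ℂ := x' (zetaOf d' K') with ha'
  have hpa : IsPrimitiveRoot a d := (IsCyclotomicExtension.zeta_spec d ℚ K).map_of_injective x.injective
  have hpa' : IsPrimitiveRoot a' d' := (IsCyclotomicExtension.zeta_spec d' ℚ K').map_of_injective x'.injective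
  have ha0 : a ≠ 0 := hpa.ne_zero (NeZero.ne d)
  have ha0' : a' ≠ 0 := hpa'.ne_zero (NeZero.ne d')
  have hwa : a - a⁻¹ ∈ E := by
    rw [hE, traceField_eq_adjoin_of_four_dvd h4 h8 h20 h24 h60 Φ hΦ x, ha, ← map_inv₀, ← map_sub]
    exact IntermediateField.mem_adjoin_simple_self ℚ _
  have hwa' : a' - a'⁻¹ ∈ E := by
    rw [heq, traceField_eq_adjoin_of_four_dvd h4' h8' h20' h24' h60' Φ' hΦ' x', ha', ← map_inv₀, ← map_sub]
    exact IntermediateField.mem_adjoin_simple_self ℚ _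
  obtain ⟨hint, h₁⟩ := finrank_adjoin_le_two_of_sub_inv_mem E ha0 hwa
  obtain ⟨hint', h₂⟩ := finrank_adjoin_le_two_of_sub_inv_mem E ha0' hwa'
  -- the compositum `S = E(a) ⊔ E(a′)` over `E`
  haveI : FiniteDimensional E (IntermediateField.adjoin E ({a} : Set ℂ)) := IntermediateField.adjoin.finiteDimensional hint
  haveI : FiniteDimensional E (IntermediateField.adjoin E ({a'} : Set ℂ)) := IntermediateField.adjoin.finiteDimensional hint'
  set S : IntermediateField E ℂ := IntermediateField.adjoin E ({a} : Set ℂ) ⊔ IntermediateField.adjoin E ({a'} : Set ℂ) with hS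
  haveI : FiniteDimensional E S := IntermediateField.finiteDimensional_sup _ _
  have hS4 : finrank E S ≤ 4 :=
    (IntermediateField.finrank_sup_le _ _).trans (by nlinarith [h₁, h₂, Nat.zero_le (finrank (↥E) ↥(IntermediateField.adjoin E ({a} : Set ℂ)))])
  haveI : FiniteDimensional ℚ S := Module.Finite.trans E S
  have htower : finrank ℚ S = finrank ℚ E * finrank E S := (Module.finrank_mul_finrank ℚ E S).symm
  -- the two primitive roots inside `S`
  have haS : a ∈ S := (le_sup_left : IntermediateField.adjoin E ({a} : Set ℂ) ≤ S) (IntermediateField.mem_adjoin_simple_self E a)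
  have ha'S : a' ∈ S := (le_sup_right : IntermediateField.adjoin E ({a'} : Set ℂ) ≤ S) (IntermediateField.mem_adjoin_simple_self E a')
  have hpaS : IsPrimitiveRoot (⟨a, haS⟩ : S) d := IsPrimitiveRoot.coe_submonoidClass_iff.1 hpa
  have hpa'S : IsPrimitiveRoot (⟨a', ha'S⟩ : S) d' := IsPrimitiveRoot.coe_submonoidClass_iff.1 hpa'
  have key := IsPrimitiveRoot.lcm_totient_le_finrank hpaS hpa'S
    (cyclotomic.irreducible_rat (Nat.lcm_pos (NeZero.pos d) (NeZero.pos d')))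
  calc Nat.totient (Nat.lcm d d') ≤ finrank ℚ S := key
    _ = finrank ℚ E * finrank E S := htower
    _ ≤ finrank ℚ E * 4 := Nat.mul_le_mul_left _ hS4
    _ = 2 * Nat.totient d := by rw [← hdeg]; ring

/-- **`d ≡ d′ ≡ 4 (mod 8)`, `d ≠ d′`: the reflex fields `K*(Φ_d) ≠ K*(Φ_{d′})` in `ℂ`** (`d, d′ ≥ 8`, `∉ {20, 60}`) — by the compositum bound,
`lcm(d, d′) ∈ {d, 3d} ∩ {d′, 3d′}` and `φ(d) = φ(d′)`, which is impossible for `d ≠ d′` (`φ(3e) ≥ 2φ(e)`).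
[cite: GalleseGoodsonLombardo2024, §3 Thm. 3.0 (5), (last statement)] [cite: Shimura1998, §8.3 Prop. 28 and §8.4 Example (1)] -/
theorem traceField_ne_of_not_eight_dvd (h4 : 4 ∣ d) (h8 : 8 ≤ d) (h20 : d ≠ 20) (h60 : d ≠ 60) (h8n : ¬ 8 ∣ d) (Φ : CMType K)
    (hΦ : ∀ σ : K →+* ℂ, σ ∈ Φ.1 ↔ 2 * (expOf d K σ).val < d)
    (h4' : 4 ∣ d') (h8' : 8 ≤ d') (h20' : d' ≠ 20) (h60' : d' ≠ 60) (h8n' : ¬ 8 ∣ d') (Φ' : CMType K')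
    (hΦ' : ∀ σ : K' →+* ℂ, σ ∈ Φ'.1 ↔ 2 * (expOf d' K' σ).val < d') (hne : d ≠ d') :
    traceField Φ ≠ traceField Φ' := by
  intro heq
  have h24 : d ≠ 24 := by rintro rfl; exact h8n ⟨3, rfl⟩
  have h24' : d' ≠ 24 := by rintro rfl; exact h8n' ⟨3, rfl⟩
  obtain ⟨hle, hφ⟩ := totient_lcm_le_of_traceField_eq h4 h8 h20 h24 h60 Φ hΦ h4' h8' h20' h24' h60' Φ' hΦ' heq
  obtain ⟨hle', -⟩ := totient_lcm_le_of_traceField_eq h4' h8' h20' h24' h60' Φ' hΦ' h4 h8 h20 h24 h60 Φ hΦ heq.symm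
  have h1 := lcm_eq_or_eq_three_mul h4 h8n h4' h8n' hle
  have h2 := lcm_eq_or_eq_three_mul h4' h8n' h4 h8n hle'
  rw [Nat.lcm_comm] at h2
  exact hne (eq_of_lcm_cases (NeZero.ne d) hφ h1 h2)

end FourModEight

/-! ## §4 All pairs: `K*(Φ_d) ≠ K*(Φ_{d′})` and `Y_d ⟂ Y_{d′}` for `d ≠ d′`; the `X_4` column and the exceptional columns -/

section AllPairs

variable {d : ℕ} [NeZero d] {K : Type} [Field K] [NumberField K] [IsCyclotomicExtension {d} ℚ K] {Φ : CMType K}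
  {A : AbelianVariety ℂ} {ι : 𝓞 K →+* End A} {θ : K →+* Module.End ℂ (complexBetti A.X 1)}
  {d' : ℕ} [NeZero d'] {K' : Type} [Field K'] [NumberField K'] [IsCyclotomicExtension {d'} ℚ K'] {Φ' : CMType K'}
  {A' : AbelianVariety ℂ} {ι' : 𝓞 K' →+* End A'} {θ' : K' →+* Module.End ℂ (complexBetti A'.X 1)}

/-- **THM. 3.0, last statement — the `Y`-part, for EVERY pair of non-exceptional levels: the CM fields `ℚ(ζ_d − ζ_d⁻¹) ⊂ ℂ` of the lower-half
types (`4 ∣ d, d′ ≥ 8`, both `∉ {20, 24, 60}`) are DISTINCT for `d ≠ d′`** (`8 ∣ d` or `8 ∣ d′`: §2 with `d ∤ d′` or `d′ ∤ d`; both `≡ 4 (mod 8)`: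
§3). [cite: GalleseGoodsonLombardo2024, §3 Thm. 3.0 (5), (last statement)] [cite: Shimura1998, §8.3 Prop. 28 and §8.4 Example (1)]
[cite: MilneCM2006, Ch. I §1 Prop. 1.18 (c)] -/
theorem traceField_ne_of_four_dvd_of_ne (h4 : 4 ∣ d) (h8 : 8 ≤ d) (h20 : d ≠ 20) (h24 : d ≠ 24) (h60 : d ≠ 60) (Φ : CMType K)
    (hΦ : ∀ σ : K →+* ℂ, σ ∈ Φ.1 ↔ 2 * (expOf d K σ).val < d)
    (h4' : 4 ∣ d') (h8' : 8 ≤ d') (h20' : d' ≠ 20) (h24' : d' ≠ 24) (h60' : d' ≠ 60) (Φ' : CMType K')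
    (hΦ' : ∀ σ : K' →+* ℂ, σ ∈ Φ'.1 ↔ 2 * (expOf d' K' σ).val < d') (hne : d ≠ d') :
    traceField Φ ≠ traceField Φ' := by
  by_cases h8d : 8 ∣ d
  · by_cases hdd : d ∣ d'
    · have h8d' : 8 ∣ d' := h8d.trans hdd
      have hnd : ¬ d' ∣ d := fun h => hne (Nat.dvd_antisymm hdd h)
      exact (traceField_ne_of_eight_dvd_of_not_dvd d h8d' h24' Φ' hΦ' h4 hnd Φ).symm
    · exact traceField_ne_of_eight_dvd_of_not_dvd d' h8d h24 Φ hΦ h4' hdd Φ'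
  · by_cases h8d' : 8 ∣ d'
    · have hnd : ¬ d' ∣ d := fun h => h8d (h8d'.trans h)
      exact (traceField_ne_of_eight_dvd_of_not_dvd d h8d' h24' Φ' hΦ' h4 hnd Φ).symm
    · exact traceField_ne_of_not_eight_dvd h4 h8 h20 h60 h8d Φ hΦ h4' h8' h20' h60' h8d' Φ' hΦ' hne

/-- **`Y_d ⟂ Y_{d′}` for all `d ≠ d′`** (`4 ∣ d, d′ ≥ 8`, both `∉ {20, 24, 60}`): for every realisation `A` of `Φ_d` and `A′` of `Φ_{d′}` (so every
`X_d ∼ Y_d²`, `Y_d`, …), `Hom(A, A′) = 0 = Hom(A′, A)` and `A`, `A′` are not isogenous. [cite: GalleseGoodsonLombardo2024, §3 Thm. 3.0 (last statement)]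
[cite: MilneCM2006, Ch. I §1 Prop. 1.18 (c) and §3 Prop. 3.13] -/
theorem orthogonal_fourDvd_of_ne (h4 : 4 ∣ d) (h8 : 8 ≤ d) (h20 : d ≠ 20) (h24 : d ≠ 24) (h60 : d ≠ 60)
    (hΦ : ∀ σ : K →+* ℂ, σ ∈ Φ.1 ↔ 2 * (expOf d K σ).val < d) (hA : IsCMTypeRealisation Φ A ι θ)
    (h4' : 4 ∣ d') (h8' : 8 ≤ d') (h20' : d' ≠ 20) (h24' : d' ≠ 24) (h60' : d' ≠ 60)
    (hΦ' : ∀ σ : K' →+* ℂ, σ ∈ Φ'.1 ↔ 2 * (expOf d' K' σ).val < d') (hA' : IsCMTypeRealisation Φ' A' ι' θ') (hne : d ≠ d') :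
    (∀ u : A ⟶ A', u = 0) ∧ (∀ v : A' ⟶ A, v = 0) ∧
      ¬ AbelianVariety.IsIsogenous A A' ∧ ¬ AbelianVariety.IsIsogenous A' A :=
  hA.orthogonal_of_traceField_ne hA' (traceField_ne_of_four_dvd_of_ne h4 h8 h20 h24 h60 Φ hΦ h4' h8' h20' h24' h60' Φ' hΦ' hne)

variable {K₄ : Type} [Field K₄] [NumberField K₄] [IsCyclotomicExtension {4} ℚ K₄] {Φ₄ : CMType K₄}
  {A₄ : AbelianVariety ℂ} {ι₄ : 𝓞 K₄ →+* End A₄} {θ₄ : K₄ →+* Module.End ℂ (complexBetti A₄.X 1)}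

/-- **The `X_4` column: `X_4 ⟂ Y_d` for every `4 ∣ d ≥ 8`, `d ∉ {12, 20, 24, 60}`** (`8 ∣ d`: `i ∉ K*(Φ_d)`, F12; `d ≡ 4 (mod 8)`, `d ∉ {4, 12}`:
reflex degrees `2 ≠ φ(d)/2`, F13) — the pair `(4, 12)` IS compatible (F12 `exists_hom_ne_zero_four_twelve`).
[cite: GalleseGoodsonLombardo2024, §3 Thm. 3.0 (5), (last statement)] [cite: MilneCM2006, Ch. I §3 Prop. 3.13] -/
theorem orthogonal_four_fourDvd_of_ne_twelve (hA₄ : IsCMTypeRealisation Φ₄ A₄ ι₄ θ₄) (h4 : 4 ∣ d) (h8 : 8 ≤ d) (h12 : d ≠ 12)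
    (h20 : d ≠ 20) (h24 : d ≠ 24) (h60 : d ≠ 60) (hΦ : ∀ σ : K →+* ℂ, σ ∈ Φ.1 ↔ 2 * (expOf d K σ).val < d)
    (hA : IsCMTypeRealisation Φ A ι θ) :
    (∀ u : A₄ ⟶ A, u = 0) ∧ (∀ v : A ⟶ A₄, v = 0) ∧
      ¬ AbelianVariety.IsIsogenous A₄ A ∧ ¬ AbelianVariety.IsIsogenous A A₄ := by
  by_cases h8d : 8 ∣ d
  · exact orthogonal_four_fourDvd_of_eight_dvd hA₄ h8d h24 hΦ hA
  · refine orthogonal_four_fourDvd_of_totient_ne_four hA₄ h4 h8 h20 h24 h60 hΦ hA ?_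
    obtain ⟨n, rfl, hn⟩ := exists_eq_four_mul_odd h4 h8d
    have hcop : Nat.Coprime 4 n := by simpa using (Nat.coprime_two_left.2 hn).pow_left 2
    rw [Nat.totient_mul hcop, show Nat.totient 4 = 2 by decide +kernel]
    intro h
    rcases eq_one_or_three_of_odd_of_totient_le_two hn (by omega) with rfl | rfl
    · omega
    · exact h12 rfl

/-- **The `Y_{24}` column: `Y_{24} ⟂ Y_d` for `4 ∣ d ≥ 8` non-exceptional with `φ(d) ≠ 4`** (reflex degrees `[ℚ(√−6) : ℚ] = 2 ≠ φ(d)/2`; the levels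
`8`, `12` of degree `4` are F17 `orthogonal_eight_twentyFour`, F16 `orthogonal_fourDvd_twentyFour_of_not_eight_dvd`).
[cite: GalleseGoodsonLombardo2024, §3 Thm. 3.0 (last statement) and §3.4] [cite: MilneCM2006, Ch. I §1 Prop. 1.18 (c) and §3 Prop. 3.13] -/
theorem orthogonal_twentyFour_fourDvd_of_totient_ne_four [IsCyclotomicExtension {24} ℚ K'] {Ψ : CMType K'}
    (hΨ : ∀ σ : K' →+* ℂ, σ ∈ Ψ.1 ↔ 2 * (expOf 24 K' σ).val < 24) (hA' : IsCMTypeRealisation Ψ A' ι' θ')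
    (h4 : 4 ∣ d) (h8 : 8 ≤ d) (h20 : d ≠ 20) (h24 : d ≠ 24) (h60 : d ≠ 60) (hφ : Nat.totient d ≠ 4)
    (hΦ : ∀ σ : K →+* ℂ, σ ∈ Φ.1 ↔ 2 * (expOf d K σ).val < d) (hA : IsCMTypeRealisation Φ A ι θ) :
    (∀ u : A' ⟶ A, u = 0) ∧ (∀ v : A ⟶ A', v = 0) ∧
      ¬ AbelianVariety.IsIsogenous A' A ∧ ¬ AbelianVariety.IsIsogenous A A' := by
  obtain ⟨x'⟩ := (inferInstance : Nonempty (K' →+* ℂ))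
  obtain ⟨-, -, h2, -⟩ := traceField_twentyFour Ψ hΨ x'
  refine hA'.orthogonal_of_finrank_traceField_ne hA fun h => hφ ?_
  rw [← two_mul_finrank_traceField_of_four_dvd h4 h8 h20 h24 h60 Φ hΦ, ← h, h2]

/-- **`Y_{24} ⟂ Y_{60}`** (reflex degrees `2 ≠ 4`). [cite: GalleseGoodsonLombardo2024, §3 Thm. 3.0 (last statement) and §3.4]
[cite: MilneCM2006, Ch. I §1 Prop. 1.18 (c) and §3 Prop. 3.13] -/
theorem orthogonal_twentyFour_sixty [IsCyclotomicExtension {24} ℚ K] [IsCyclotomicExtension {60} ℚ K']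
    (hΦ : ∀ σ : K →+* ℂ, σ ∈ Φ.1 ↔ 2 * (expOf 24 K σ).val < 24) (hA : IsCMTypeRealisation Φ A ι θ)
    (hΦ' : ∀ σ : K' →+* ℂ, σ ∈ Φ'.1 ↔ 2 * (expOf 60 K' σ).val < 60) (hA' : IsCMTypeRealisation Φ' A' ι' θ') :
    (∀ u : A ⟶ A', u = 0) ∧ (∀ v : A' ⟶ A, v = 0) ∧
      ¬ AbelianVariety.IsIsogenous A A' ∧ ¬ AbelianVariety.IsIsogenous A' A := by
  obtain ⟨x⟩ := (inferInstance : Nonempty (K →+* ℂ))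
  obtain ⟨x'⟩ := (inferInstance : Nonempty (K' →+* ℂ))
  obtain ⟨-, -, h2, -⟩ := traceField_twentyFour Φ hΦ x
  obtain ⟨-, -, h4, -⟩ := traceField_sixty Φ' hΦ' x'
  refine hA.orthogonal_of_finrank_traceField_ne hA' ?_
  rw [h2, h4]
  decide

/-- **The `Y_{60}` column at equal degree: `Y_{16} ⟂ Y_{60}`** — more generally `Y_d ⟂ Y_{60}` for every `8 ∣ d`, `d ≠ 24` (`d ∤ 60`; §2) — the
one pair the degree count `φ(d) ≠ 8` of F20 `orthogonal_fourDvd_sixty_of_totient_ne_eight` left open.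
[cite: GalleseGoodsonLombardo2024, §3 Thm. 3.0 (last statement) and §3.4] [cite: MilneCM2006, Ch. I §3 Prop. 3.13] -/
theorem orthogonal_sixty_fourDvd_of_eight_dvd [IsCyclotomicExtension {60} ℚ K'] {Ψ : CMType K'} (hA' : IsCMTypeRealisation Ψ A' ι' θ')
    (h8d : 8 ∣ d) (h24 : d ≠ 24) (hΦ : ∀ σ : K →+* ℂ, σ ∈ Φ.1 ↔ 2 * (expOf d K σ).val < d) (hA : IsCMTypeRealisation Φ A ι θ) :
    (∀ u : A ⟶ A', u = 0) ∧ (∀ v : A' ⟶ A, v = 0) ∧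
      ¬ AbelianVariety.IsIsogenous A A' ∧ ¬ AbelianVariety.IsIsogenous A' A :=
  orthogonal_fourDvd_of_eight_dvd_of_not_dvd 60 h8d h24 hΦ hA ⟨15, rfl⟩ (fun h => by
    obtain ⟨e, he⟩ := h8d.trans h
    omega) hA'

end AllPairs

end HyperellipticJacobian

end Literature.AlgebraicGeometry.ComplexMultiplication

end
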